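import Mathlib
import Summits.CriticalPhenomena.PercolationContinuityZ3.Theorems.PercNearOneGluingNoHeavyLowerTailOrientedAntipodalHallOrderedAssignmentSDR

/-!
# Theorem O for the transitive triangle with a pendant arc (four petals)

Helper file for crux `stmt-CriticalPhenomena-4575` (`NoHeavyLowerTail`, route `PercNearOneGluingNoHeavy`),
new-inequality factory seat `prim-ineq-gen-3` (gen 11).  Everything here is PROVED.

The smallest opposite-free type class on four petals left open by the gen-10 master theorem (memo PAPER-THREEFAMILY.md §5) is the
transitive triangle `(i,j), (i,l), (j,l)` together with an arc `(m,i)` INTO its source.  It is an instance of the master theorem with an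
ORDERED MIDDLE GROUP (`OrientedAntipodalHall.card_le_card_goods_above_of_ordered_assignment`, gen 11):
`D_{ij} ↦ (D₁, complemented)`, `D_{il} ↦ (D₂, plain)`, `D_{mi} ↦ (D₂, complemented)`, `D_{jl} ↦ (D₃, complemented)`; oriented member labels
`(j|i), (i|l), (i|m), (l|j)`.

* `card_le_card_goods_above_triangle_pendant` — `#D_{ij} + #D_{il} + #D_{jl} + #D_{mi} ≤ #{goods above a bad}`;
* `exists_injective_good_above_triangle_pendant` — distinct good representatives (Conjecture O for this class and, by symmetry under
  reversal of all types, for the triangle with an arc OUT OF its sink).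
(prim-ineq-gen-3 gen 11, 2026-08-20.)
-/

namespace Summit.CriticalPhenomena.PercolationContinuityZ3.Theorems

namespace OrientedAntipodalHall

open Finset AntipodalStrongHarris AntipodalStrongHarris.Lab
open scoped FinsetFamily

variable {α : Type*} [DecidableEq α] {k : ℕ}

/-- The transitive triangle `(i,j), (i,l), (j,l)` with a pendant in-arc `(m,i)`: count AND distinct representatives (see the two
corollaries below). -/
theorem triangle_pendant_aux (S : Finset α) {f : Finset α → Lab k}
    (hf : ∀ ⦃X Y : Finset α⦄, X ⊆ Y → f X ≤ f Y) (D₁ D₂ D₃ D₄ : Finset (Finset α)) {i j l m : Fin k}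
    (hij : i ≠ j) (hjl : j ≠ l) (hil : i ≠ l) (hmi : m ≠ i) (hmj : m ≠ j) (hml : m ≠ l)
    (h₁S : ∀ X ∈ D₁, X ⊆ S) (h₁i : ∀ X ∈ D₁, f X = petal i) (h₁j : ∀ X ∈ D₁, f (S \ X) = petal j)
    (h₂S : ∀ X ∈ D₂, X ⊆ S) (h₂i : ∀ X ∈ D₂, f X = petal i) (h₂l : ∀ X ∈ D₂, f (S \ X) = petal l)
    (h₃S : ∀ X ∈ D₃, X ⊆ S) (h₃j : ∀ X ∈ D₃, f X = petal j) (h₃l : ∀ X ∈ D₃, f (S \ X) = petal l)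
    (h₄S : ∀ X ∈ D₄, X ⊆ S) (h₄m : ∀ X ∈ D₄, f X = petal m) (h₄i : ∀ X ∈ D₄, f (S \ X) = petal i) :
    #D₁ + #(D₂ ∪ D₄) + #D₃ ≤
        #{U ∈ S.powerset | f U = top ∧ f (S \ U) = bot ∧ ∃ X ∈ D₁ ∪ (D₂ ∪ D₄) ∪ D₃, X ⊆ U} ∧
      ∃ φ : ↥(D₁ ∪ (D₂ ∪ D₄) ∪ D₃) → Finset α, Function.Injective φ ∧
        ∀ X : ↥(D₁ ∪ (D₂ ∪ D₄) ∪ D₃), (X : Finset α) ⊆ φ X ∧ φ X ⊆ S ∧ f (φ X) = top ∧ f (S \ φ X) = bot := by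
  -- pairwise disjointness of the four families (their label pairs differ)
  have pinj : ∀ {p q : Fin k}, (petal p : Lab k) = petal q → p = q := fun h => Lab.petal.inj h
  have d12 : ∀ X ∈ D₁, X ∉ D₂ := fun X h1 h2 => hjl (pinj ((h₁j X h1).symm.trans (h₂l X h2)))
  have d13 : ∀ X ∈ D₁, X ∉ D₃ := fun X h1 h3 => hij (pinj ((h₁i X h1).symm.trans (h₃j X h3)))
  have d14 : ∀ X ∈ D₁, X ∉ D₄ := fun X h1 h4 => hmi (pinj ((h₄m X h4).symm.trans (h₁i X h1)))
  have d23 : ∀ X ∈ D₂, X ∉ D₃ := fun X h2 h3 => hij (pinj ((h₂i X h2).symm.trans (h₃j X h3)))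
  have d24 : ∀ X ∈ D₂, X ∉ D₄ := fun X h2 h4 => hmi (pinj ((h₄m X h4).symm.trans (h₂i X h2)))
  have d34 : ∀ X ∈ D₃, X ∉ D₄ := fun X h3 h4 => hmj (pinj ((h₄m X h4).symm.trans (h₃j X h3)))
  -- the assignment
  let cpl : Finset α → Bool := fun X => if X ∈ D₂ then false else true
  let a : Finset α → Fin k := fun X => if X ∈ D₁ then j else if X ∈ D₂ then i else if X ∈ D₄ then i else l
  let b : Finset α → Fin k := fun X => if X ∈ D₁ then i else if X ∈ D₂ then l else if X ∈ D₄ then m else j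
  have ev1 : ∀ X ∈ D₁, cpl X = true ∧ a X = j ∧ b X = i := by
    intro X hX; simp [cpl, a, b, hX, d12 X hX]
  have ev2 : ∀ X ∈ D₂, cpl X = false ∧ a X = i ∧ b X = l := by
    intro X hX
    have h1 : X ∉ D₁ := fun h => d12 X h hX
    simp [cpl, a, b, hX, h1]
  have ev3 : ∀ X ∈ D₃, cpl X = true ∧ a X = l ∧ b X = j := by
    intro X hX
    have h1 : X ∉ D₁ := fun h => d13 X h hX
    have h2 : X ∉ D₂ := fun h => d23 X h hX
    have h4 : X ∉ D₄ := fun h => d34 X hX h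
    simp [cpl, a, b, h1, h2, h4]
  have ev4 : ∀ X ∈ D₄, cpl X = true ∧ a X = i ∧ b X = m := by
    intro X hX
    have h1 : X ∉ D₁ := fun h => d14 X h hX
    have h2 : X ∉ D₂ := fun h => d24 X h hX
    simp [cpl, a, b, hX, h1, h2]
  -- the hypotheses of the master theorem
  have hlab : ∀ X ∈ D₁ ∪ (D₂ ∪ D₄) ∪ D₃, X ⊆ S ∧ (cpl X = false → f X = petal (a X) ∧ f (S \ X) = petal (b X)) ∧
      (cpl X = true → f (S \ X) = petal (a X) ∧ f X = petal (b X)) := by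
    intro X hX
    rcases mem_union.mp hX with hX | hX
    · rcases mem_union.mp hX with hX | hX
      · obtain ⟨hc, ha, hb⟩ := ev1 X hX
        refine ⟨h₁S X hX, fun h => ?_, fun _ => ?_⟩
        · rw [hc] at h; exact absurd h (by decide)
        · rw [ha, hb]; exact ⟨h₁j X hX, h₁i X hX⟩
      · rcases mem_union.mp hX with hX | hX
        · obtain ⟨hc, ha, hb⟩ := ev2 X hX
          refine ⟨h₂S X hX, fun _ => ?_, fun h => ?_⟩
          · rw [ha, hb]; exact ⟨h₂i X hX, h₂l X hX⟩
          · rw [hc] at h; exact absurd h (by decide)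
        · obtain ⟨hc, ha, hb⟩ := ev4 X hX
          refine ⟨h₄S X hX, fun h => ?_, fun _ => ?_⟩
          · rw [hc] at h; exact absurd h (by decide)
          · rw [ha, hb]; exact ⟨h₄i X hX, h₄m X hX⟩
    · obtain ⟨hc, ha, hb⟩ := ev3 X hX
      refine ⟨h₃S X hX, fun h => ?_, fun _ => ?_⟩
      · rw [hc] at h; exact absurd h (by decide)
      · rw [ha, hb]; exact ⟨h₃l X hX, h₃j X hX⟩
  have hW₁ : ∀ X ∈ D₁, ∀ X' ∈ D₁, cpl X = cpl X' ∧ a X ≠ b X' ∧ b X ≠ a X' := by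
    intro X hX X' hX'
    obtain ⟨hc, ha, hb⟩ := ev1 X hX; obtain ⟨hc', ha', hb'⟩ := ev1 X' hX'
    rw [hc, hc', ha, hb, ha', hb']; exact ⟨rfl, hij.symm, hij⟩
  have hW₂ : ∀ X ∈ D₂ ∪ D₄, ∀ X' ∈ D₂ ∪ D₄, a X ≠ b X' ∧ b X ≠ a X' ∧
      (cpl X = true → cpl X' = false → ¬ (a X = a X' ∧ b X = b X')) := by
    intro X hX X' hX'
    rcases mem_union.mp hX with hX | hX <;> rcases mem_union.mp hX' with hX' | hX'
    · obtain ⟨hc, ha, hb⟩ := ev2 X hX; obtain ⟨hc', ha', hb'⟩ := ev2 X' hX'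
      rw [hc, ha, hb, ha', hb']
      exact ⟨hil, hil.symm, fun h => absurd h (by decide)⟩
    · obtain ⟨hc, ha, hb⟩ := ev2 X hX; obtain ⟨hc', ha', hb'⟩ := ev4 X' hX'
      rw [hc, ha, hb, ha', hb']
      exact ⟨hmi.symm, hil.symm, fun h => absurd h (by decide)⟩
    · obtain ⟨hc, ha, hb⟩ := ev4 X hX; obtain ⟨hc', ha', hb'⟩ := ev2 X' hX'
      rw [hc, hc', ha, hb, ha', hb']
      exact ⟨hil, hmi, fun _ _ h => hml h.2⟩
    · obtain ⟨hc, ha, hb⟩ := ev4 X hX; obtain ⟨hc', ha', hb'⟩ := ev4 X' hX'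
      rw [hc, hc', ha, hb, ha', hb']
      exact ⟨hmi.symm, hmi, fun _ h => absurd h (by decide)⟩
  have hW₃ : ∀ X ∈ D₃, ∀ X' ∈ D₃, cpl X = cpl X' ∧ a X ≠ b X' ∧ b X ≠ a X' := by
    intro X hX X' hX'
    obtain ⟨hc, ha, hb⟩ := ev3 X hX; obtain ⟨hc', ha', hb'⟩ := ev3 X' hX'
    rw [hc, hc', ha, hb, ha', hb']; exact ⟨rfl, hjl.symm, hjl⟩
  have hC₁₂ : ∀ X ∈ D₁, ∀ Y ∈ D₂ ∪ D₄, a X ≠ a Y ∧ b X ≠ b Y ∧ (cpl X = true ∨ cpl Y = true) ∧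
      ¬ (a X = b Y ∧ a Y = b X) := by
    intro X hX Y hY
    obtain ⟨hc, ha, hb⟩ := ev1 X hX
    rcases mem_union.mp hY with hY | hY
    · obtain ⟨hc', ha', hb'⟩ := ev2 Y hY
      rw [hc, ha, hb, ha', hb']; exact ⟨hij.symm, hil, Or.inl rfl, fun h => hjl h.1⟩
    · obtain ⟨hc', ha', hb'⟩ := ev4 Y hY
      rw [hc, ha, hb, ha', hb']; exact ⟨hij.symm, hmi.symm, Or.inl rfl, fun h => hmj.symm h.1⟩
  have hC₂₃ : ∀ Y ∈ D₂ ∪ D₄, ∀ Z ∈ D₃, a Y ≠ a Z ∧ b Y ≠ b Z ∧ (cpl Y = true ∨ cpl Z = true) ∧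
      ¬ (a Y = b Z ∧ a Z = b Y) := by
    intro Y hY Z hZ
    obtain ⟨hc', ha', hb'⟩ := ev3 Z hZ
    rcases mem_union.mp hY with hY | hY
    · obtain ⟨hc, ha, hb⟩ := ev2 Y hY
      rw [hc', ha, hb, ha', hb']; exact ⟨hil, hjl.symm, Or.inr rfl, fun h => hij h.1⟩
    · obtain ⟨hc, ha, hb⟩ := ev4 Y hY
      rw [hc', ha, hb, ha', hb']; exact ⟨hil, hmj, Or.inr rfl, fun h => hij h.1⟩
  have hC₃₁ : ∀ Z ∈ D₃, ∀ X ∈ D₁, a Z ≠ a X ∧ b Z ≠ b X ∧ (cpl Z = true ∨ cpl X = true) ∧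
      ¬ (a Z = b X ∧ a X = b Z) := by
    intro Z hZ X hX
    obtain ⟨hc, ha, hb⟩ := ev3 Z hZ; obtain ⟨hc', ha', hb'⟩ := ev1 X hX
    rw [hc, ha, hb, ha', hb']; exact ⟨hjl.symm, hij.symm, Or.inl rfl, fun h => hil.symm h.1⟩
  have hDD₁ : ∀ X ∈ D₁, ∀ Y ∈ D₂ ∪ D₄, ∀ Z ∈ D₃,
      ¬ (a X = b Y ∧ b Y = b Z) ∧ ¬ (b X = a Y ∧ a Y = a Z) ∧ (cpl X = true ∨ cpl Y = false ∨ cpl Z = false) := by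
    intro X hX Y hY Z hZ
    obtain ⟨hc, ha, hb⟩ := ev1 X hX; obtain ⟨hc'', ha'', hb''⟩ := ev3 Z hZ
    rcases mem_union.mp hY with hY | hY
    · obtain ⟨hc', ha', hb'⟩ := ev2 Y hY
      rw [hc, ha, hb, ha', hb', ha'', hb'']; exact ⟨fun h => hjl h.1, fun h => hil h.2, Or.inl rfl⟩
    · obtain ⟨hc', ha', hb'⟩ := ev4 Y hY
      rw [hc, ha, hb, ha', hb', ha'', hb'']; exact ⟨fun h => hmj.symm h.1, fun h => hil h.2, Or.inl rfl⟩
  have hDD₃ : ∀ X ∈ D₁, ∀ Y ∈ D₂ ∪ D₄, ∀ Z ∈ D₃,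
      ¬ (a Z = b X ∧ b X = b Y) ∧ ¬ (b Z = a X ∧ a X = a Y) ∧ (cpl Z = true ∨ cpl X = false ∨ cpl Y = false) := by
    intro X hX Y hY Z hZ
    obtain ⟨hc, ha, hb⟩ := ev1 X hX; obtain ⟨hc'', ha'', hb''⟩ := ev3 Z hZ
    rcases mem_union.mp hY with hY | hY
    · obtain ⟨hc', ha', hb'⟩ := ev2 Y hY
      rw [hc'', ha, hb, ha', hb', ha'', hb'']; exact ⟨fun h => hil.symm h.1, fun h => hij.symm h.2, Or.inl rfl⟩
    · obtain ⟨hc', ha', hb'⟩ := ev4 Y hY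
      rw [hc'', ha, hb, ha', hb', ha'', hb'']; exact ⟨fun h => hil.symm h.1, fun h => hij.symm h.2, Or.inl rfl⟩
  exact ⟨card_le_card_goods_above_of_ordered_assignment S hf D₁ (D₂ ∪ D₄) D₃ cpl a b hlab hW₁ hW₂ hW₃ hC₁₂ hC₂₃
      hC₃₁ hDD₁ hDD₃,
    exists_injective_good_above_of_ordered_assignment S hf D₁ (D₂ ∪ D₄) D₃ cpl a b hlab hW₁ hW₂ hW₃ hC₁₂ hC₂₃
      hC₃₁ hDD₁ hDD₃⟩

/-- **Theorem O (count) for the transitive triangle with a pendant in-arc.**  For a monotone `Lab`-labeling of the subsets of `S`,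
four pairwise distinct petals `i, j, l, m` and families `D₁, D₂, D₃, D₄` of antipodal bads of the types `(i,j), (i,l), (j,l), (m,i)`, at
least `#D₁ + #D₂ + #D₃ + #D₄` good sets contain a member of `D₁ ∪ D₂ ∪ D₃ ∪ D₄`. -/
theorem card_le_card_goods_above_triangle_pendant (S : Finset α) {f : Finset α → Lab k}
    (hf : ∀ ⦃X Y : Finset α⦄, X ⊆ Y → f X ≤ f Y) (D₁ D₂ D₃ D₄ : Finset (Finset α)) {i j l m : Fin k}
    (hij : i ≠ j) (hjl : j ≠ l) (hil : i ≠ l) (hmi : m ≠ i) (hmj : m ≠ j) (hml : m ≠ l)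
    (h₁S : ∀ X ∈ D₁, X ⊆ S) (h₁i : ∀ X ∈ D₁, f X = petal i) (h₁j : ∀ X ∈ D₁, f (S \ X) = petal j)
    (h₂S : ∀ X ∈ D₂, X ⊆ S) (h₂i : ∀ X ∈ D₂, f X = petal i) (h₂l : ∀ X ∈ D₂, f (S \ X) = petal l)
    (h₃S : ∀ X ∈ D₃, X ⊆ S) (h₃j : ∀ X ∈ D₃, f X = petal j) (h₃l : ∀ X ∈ D₃, f (S \ X) = petal l)
    (h₄S : ∀ X ∈ D₄, X ⊆ S) (h₄m : ∀ X ∈ D₄, f X = petal m) (h₄i : ∀ X ∈ D₄, f (S \ X) = petal i) :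
    #D₁ + #D₂ + #D₃ + #D₄ ≤
      #{U ∈ S.powerset | f U = top ∧ f (S \ U) = bot ∧ ∃ X ∈ D₁ ∪ D₂ ∪ D₃ ∪ D₄, X ⊆ U} := by
  obtain ⟨hcount, -⟩ := triangle_pendant_aux S hf D₁ D₂ D₃ D₄ hij hjl hil hmi hmj hml h₁S h₁i h₁j h₂S h₂i h₂l
    h₃S h₃j h₃l h₄S h₄m h₄i
  have d24 : Disjoint D₂ D₄ := by
    rw [Finset.disjoint_left]
    intro X h2 h4
    exact hmi (Lab.petal.inj ((h₄m X h4).symm.trans (h₂i X h2)))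
  have hU : D₁ ∪ (D₂ ∪ D₄) ∪ D₃ = D₁ ∪ D₂ ∪ D₃ ∪ D₄ := by
    ext X; simp only [mem_union]; tauto
  rw [card_union_of_disjoint d24, hU] at hcount
  omega

/-- **Theorem O (SDR form) for the transitive triangle with a pendant in-arc.**  Under the same hypotheses the bads of
`D₁ ∪ D₂ ∪ D₃ ∪ D₄` admit DISTINCT good representatives above them. -/
theorem exists_injective_good_above_triangle_pendant (S : Finset α) {f : Finset α → Lab k}
    (hf : ∀ ⦃X Y : Finset α⦄, X ⊆ Y → f X ≤ f Y) (D₁ D₂ D₃ D₄ : Finset (Finset α)) {i j l m : Fin k}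
    (hij : i ≠ j) (hjl : j ≠ l) (hil : i ≠ l) (hmi : m ≠ i) (hmj : m ≠ j) (hml : m ≠ l)
    (h₁S : ∀ X ∈ D₁, X ⊆ S) (h₁i : ∀ X ∈ D₁, f X = petal i) (h₁j : ∀ X ∈ D₁, f (S \ X) = petal j)
    (h₂S : ∀ X ∈ D₂, X ⊆ S) (h₂i : ∀ X ∈ D₂, f X = petal i) (h₂l : ∀ X ∈ D₂, f (S \ X) = petal l)
    (h₃S : ∀ X ∈ D₃, X ⊆ S) (h₃j : ∀ X ∈ D₃, f X = petal j) (h₃l : ∀ X ∈ D₃, f (S \ X) = petal l)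
    (h₄S : ∀ X ∈ D₄, X ⊆ S) (h₄m : ∀ X ∈ D₄, f X = petal m) (h₄i : ∀ X ∈ D₄, f (S \ X) = petal i) :
    ∃ φ : ↥(D₁ ∪ D₂ ∪ D₃ ∪ D₄) → Finset α, Function.Injective φ ∧
      ∀ X : ↥(D₁ ∪ D₂ ∪ D₃ ∪ D₄), (X : Finset α) ⊆ φ X ∧ φ X ⊆ S ∧ f (φ X) = top ∧ f (S \ φ X) = bot := by
  obtain ⟨-, φ, hφ, hgood⟩ := triangle_pendant_aux S hf D₁ D₂ D₃ D₄ hij hjl hil hmi hmj hml h₁S h₁i h₁j h₂S h₂i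
    h₂l h₃S h₃j h₃l h₄S h₄m h₄i
  have hU : D₁ ∪ (D₂ ∪ D₄) ∪ D₃ = D₁ ∪ D₂ ∪ D₃ ∪ D₄ := by
    ext X; simp only [mem_union]; tauto
  let e : ↥(D₁ ∪ D₂ ∪ D₃ ∪ D₄) → ↥(D₁ ∪ (D₂ ∪ D₄) ∪ D₃) := fun X => ⟨X, by rw [hU]; exact X.2⟩
  have he : Function.Injective e := fun X Y h => Subtype.ext (by simpa [e] using congrArg Subtype.val h)
  exact ⟨φ ∘ e, hφ.comp he, fun X => hgood (e X)⟩

end OrientedAntipodalHall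

end Summit.CriticalPhenomena.PercolationContinuityZ3.Theorems
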